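import Mathlib
import Literature.NumberTheory.Automorphic.HilbertModularFormQExpansion

/-!
# A height `ν ↦ ∑_σ y_σ σ(ν)` injective on a totally real field (stub U3 of line Sketch-ideate-r1-k1)

For a totally real number field `F` we produce weights `y : (F →+* ℝ) → ℝ`, all strictly positive, such
that the real "height" `λ_y ν := ∑_σ y_σ σ(ν)` (sum over the real embeddings `σ : F →+* ℝ`) is injective
on `F`.  Section U of the line orders the `q`-expansion indices `ν ∈ F` of Hilbert modular forms by such a
height; injectivity is what makes leading exponents unique.

Proof outline (Lebesgue measure on the weight space `(F →+* ℝ) → ℝ`).  The height is additive in `ν`,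
so injectivity amounts to `λ_y ν ≠ 0` for every `ν ≠ 0`.  For a fixed `ν ≠ 0` the bad weights
`{y | ∑_σ y_σ σ(ν) = 0}` form the kernel of the linear functional `ℓ_ν y := ∑_σ y_σ σ(ν)`; this functional
is non-zero (its value at the coordinate vector `e_{σ₀}` is `σ₀ ν ≠ 0`, and a real embedding `σ₀` exists
because `F` is totally real), so its kernel is a proper subspace, hence Lebesgue-null
(`MeasureTheory.Measure.addHaar_submodule`).  A number field is countable, so the union of all the bad
kernels is null, whereas the open orthant `{y | ∀ σ, 0 < y σ}` has positive Lebesgue measure; any weight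
`y` in the orthant and outside the union does the job.
-/

set_option linter.dupNamespace false

noncomputable section

namespace Summit.Langlands.Langlands.Theorems.HilbertIntegralOverconvergentIsCongruence

open MeasureTheory NumberField

/-- A totally real number field has a real embedding (any complex embedding is real). -/
theorem gh_nonempty_realEmbedding (F : Type) [Field F] [NumberField F] [NumberField.IsTotallyReal F] :
    Nonempty (F →+* ℝ) := by
  obtain ⟨φ⟩ : Nonempty (F →+* ℂ) := inferInstance
  exact ⟨(NumberField.IsTotallyReal.complexEmbedding_isReal φ).embedding⟩

/-- For `ν ≠ 0` in a totally real number field `F`, the weights `y` with `∑_σ y_σ σ(ν) = 0` form a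
Lebesgue-null subset of `(F →+* ℝ) → ℝ`: they are the kernel of the non-zero linear functional
`y ↦ ∑_σ y_σ σ(ν)`, a proper subspace. -/
theorem gh_volume_heightKernel_eq_zero (F : Type) [Field F] [NumberField F] [NumberField.IsTotallyReal F]
    {ν : F} (hν : ν ≠ 0) :
    volume {y : (F →+* ℝ) → ℝ | ∑ σ : F →+* ℝ, y σ * σ ν = 0} = 0 := by
  classical
  -- the height functional `y ↦ ∑_σ y_σ σ(ν)` as an `ℝ`-linear map on the weight space
  let L : ((F →+* ℝ) → ℝ) →ₗ[ℝ] ℝ :=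
    { toFun := fun y ↦ ∑ σ : F →+* ℝ, y σ * σ ν
      map_add' := fun y y' ↦ by
        simp only [Pi.add_apply, add_mul, Finset.sum_add_distrib]
      map_smul' := fun c y ↦ by
        simp only [Pi.smul_apply, smul_eq_mul, RingHom.id_apply, Finset.mul_sum, mul_assoc] }
  have hset : {y : (F →+* ℝ) → ℝ | ∑ σ : F →+* ℝ, y σ * σ ν = 0} =
      (LinearMap.ker L : Set ((F →+* ℝ) → ℝ)) := by
    ext y
    simp only [Set.mem_setOf_eq, SetLike.mem_coe, LinearMap.mem_ker]
    rfl
  -- the functional is non-zero: evaluate at the coordinate vector of a real embedding `σ₀`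
  have hne : LinearMap.ker L ≠ ⊤ := by
    obtain ⟨σ₀⟩ := gh_nonempty_realEmbedding F
    intro htop
    have hmem : Pi.single σ₀ (1 : ℝ) ∈ LinearMap.ker L := by
      rw [htop]
      exact Submodule.mem_top
    rw [LinearMap.mem_ker] at hmem
    simp only [L, LinearMap.coe_mk, AddHom.coe_mk, Pi.single_apply, ite_mul, one_mul, zero_mul,
      Finset.sum_ite_eq', Finset.mem_univ, if_true] at hmem
    exact (map_ne_zero σ₀).mpr hν hmem
  rw [hset]
  exact Measure.addHaar_submodule volume _ hne

/-- **Stub U3 (a height injective on `F`).** Over a totally real number field `F` there are weights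
`y ≫ 0` on the real embeddings such that the height `ν ↦ ∑_σ y_σ σ(ν)` is injective on `F`: for `ν ≠ 0`
the bad weights form a proper hyperplane of `ℝ^{Hom(F,ℝ)}`, `F` is countable, and a countable union of
Lebesgue-null hyperplanes cannot cover the open orthant. -/
theorem stub_generic_height (F : Type) [Field F] [NumberField F] [NumberField.IsTotallyReal F] :
    ∃ y : (F →+* ℝ) → ℝ, (∀ σ, 0 < y σ) ∧ Function.Injective (fun ν : F ↦ ∑ σ : F →+* ℝ, y σ * σ ν) := by
  classical
  haveI : Countable F := Finsupp.Countable.of_moduleFinite (R := ℚ)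
  -- the bad weights: for some `ν ≠ 0` the height of `ν` vanishes; a countable union of null sets
  have hnull : volume (⋃ ν ∈ {ν : F | ν ≠ 0},
      {y : (F →+* ℝ) → ℝ | ∑ σ : F →+* ℝ, y σ * σ ν = 0}) = 0 :=
    (measure_biUnion_null_iff (Set.to_countable _)).2 fun _ hν ↦
      gh_volume_heightKernel_eq_zero F hν
  -- the open orthant has positive measure, so it is not covered by the bad weights
  have hopen : IsOpen (Set.pi Set.univ fun _ : F →+* ℝ ↦ Set.Ioi (0 : ℝ)) :=
    isOpen_set_pi Set.finite_univ fun _ _ ↦ isOpen_Ioi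
  have hpos : volume ((Set.pi Set.univ fun _ : F →+* ℝ ↦ Set.Ioi (0 : ℝ)) \
      ⋃ ν ∈ {ν : F | ν ≠ 0}, {y : (F →+* ℝ) → ℝ | ∑ σ : F →+* ℝ, y σ * σ ν = 0}) ≠ 0 := by
    rw [measure_sdiff_null hnull]
    exact hopen.measure_ne_zero volume ⟨fun _ ↦ 1, fun _ _ ↦ Set.mem_Ioi.2 one_pos⟩
  obtain ⟨y, hyO, hybad⟩ := nonempty_of_measure_ne_zero hpos
  refine ⟨y, fun σ ↦ Set.mem_Ioi.1 (Set.mem_univ_pi.1 hyO σ), fun ν ν' h ↦ ?_⟩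
  -- injectivity: `λ_y ν = λ_y ν'` gives `λ_y (ν - ν') = 0`, so `ν - ν' = 0` as `y` is not bad
  by_contra hne
  refine hybad (Set.mem_iUnion₂.2 ⟨ν - ν', sub_ne_zero.2 hne, ?_⟩)
  have h' : ∑ σ : F →+* ℝ, y σ * σ ν = ∑ σ : F →+* ℝ, y σ * σ ν' := h
  simp only [Set.mem_setOf_eq, map_sub, mul_sub, Finset.sum_sub_distrib, h', sub_self]

end Summit.Langlands.Langlands.Theorems.HilbertIntegralOverconvergentIsCongruence

end
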